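import Summits.AnomalousDissipation.AnomalousDissipation.Theses.MarginalStabilityChain
import Summits.AnomalousDissipation.AnomalousDissipation.Theorems.MarginalStabilityChainStrainedLayerLawSumRuleLine
import Literature.Analysis.FluidPDE.StretchedLayerNS

/-!
# Sketch — first lemmas for two round-2 crux ideas on `MarginalStabilityChain.StrainedLayerLaw`
(planner crux-ideate, round 2, ideator k = 4). Statements (`def … : Prop`) plus ONE proved transfer lemma.

* Idea `log-enstrophy-clock-nash-roundness` (§B): `negMass`, `negEnstrophy`, `negPalinstrophy`,
  `nashRoundness`, `NegEnstrophyLaw`, `CirculationFloor`, `NashRoundnessFloor`, and the PROVED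
  real-analysis transfer `clockTransfer` (log-enstrophy clock + roundness floor ⇒ time-mean enstrophy floor).
* Idea `ordered-ribbon-forged-core` (§A): `IsForgeTrajectory`, `KidaNeuForge` (the compressed
  Kirchhoff–Kida–Neu ellipse: fast-rotation boundedness of the aspect ratio), `RibbonDatum`
  (admissibility of the ordered-ribbon perturbation), `RibbonRoundnessFloor` (the line's dynamical stub,
  = §B's floor instantiated on the ribbon datum).

Vocabulary reused from the landed sum-rule line file (`InCruxClass`, `IsAdmissible`, `vorticity`, `ExpTails`)
and from `Literature.Analysis.FluidPDE.StretchedLayerNS` (`dX`, `dY`, `IsStretchedLayerNSSolutionOn`,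
`layerDissipation`).
-/

noncomputable section

set_option linter.dupNamespace false

open MeasureTheory Set Filter Topology
open scoped ENNReal
open Literature.Analysis.FluidPDE Literature.Analysis.FluidPDE.StretchedLayer
open Summit.AnomalousDissipation.AnomalousDissipation.Theorems.StrainedLayerLaw.StrainWorkSumRule

namespace Summit.AnomalousDissipation.AnomalousDissipation.Cruxes.StrainedLayerLaw.SketchR2K4

/-! ## §B — the log-enstrophy clock and Nash roundness -/

/-- Mass of the NEGATIVE vorticity of a plane slice over one period strip: `M₋ = ∫∫ ω₋`, `ω₋ = max(−ω, 0)`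
(the layer's vorticity is negative; `M₋ ≥ L` by the circulation budget). Iterated Bochner integrals. -/
def negMass (L : ℝ) (u v : ℝ → ℝ → ℝ) : ℝ :=
  ∫ x in Ioc 0 L, ∫ y, max (-(vorticity u v x y)) 0

/-- Enstrophy of the negative vorticity: `Ω₋ = ∫∫ ω₋²`. -/
def negEnstrophy (L : ℝ) (u v : ℝ → ℝ → ℝ) : ℝ :=
  ∫ x in Ioc 0 L, ∫ y, (max (-(vorticity u v x y)) 0) ^ 2

/-- Palinstrophy of the negative vorticity: `P₋ = ∫∫_{ω<0} |∇ω|²` (`= ∫∫ |∇ω₋|²` a.e.). -/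
def negPalinstrophy (L : ℝ) (u v : ℝ → ℝ → ℝ) : ℝ :=
  ∫ x in Ioc 0 L, ∫ y,
    if vorticity u v x y < 0 then (dX (vorticity u v) x y) ^ 2 + (dY (vorticity u v) x y) ^ 2 else 0

/-- **Nash roundness** of the negative vorticity of a slice: the scale-free, amplitude-free, `ν`-free shape
number `r = Ω₋² / (M₋² P₋)`. One Gaussian core of ANY size: `1/4π ≈ 0.0796`; `N` equal far-apart cores:
`1/(4πN)`; an elliptical Gaussian of aspect ratio `λ`: `1/(2π(λ + 1/λ))`; the `x`-uniform Gaussian SHEET of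
thickness `δ`: `δ/(√π L) → 0`; bounded above on `ℝ²` by Nash's inequality `‖ρ‖₂² ≤ C ‖ρ‖₁ ‖∇ρ‖₂`. Junk `0` when `M₋ P₋ = 0`. -/
def nashRoundness (L : ℝ) (u v : ℝ → ℝ → ℝ) : ℝ :=
  negEnstrophy L u v ^ 2 / (negMass L u v ^ 2 * negPalinstrophy L u v)

/-- **B1 · the negative-enstrophy law (exact, interface-free).** For classical solutions of the stretched 2-D
Navier–Stokes class (`γ = ΔU = 1`) that are `C³` in space on `t > 0` and have exponential shear tails on
`[a, b] ⊂ (0, ∞)`:  `Ω₋(b) − Ω₋(a) = ∫_a^b (Ω₋(t) − 2ν P₋(t)) dt`.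
Derivation: the vorticity equation is in conservation form `ωₜ + div(ω U⃗) = νΔω`, `U⃗ = (u, v − y)`,
`div U⃗ = −1`; multiply by `F′(ω)` with `F(s) = (s₋)²` (`C^{1,1}`, `F′(0) = 0`): transport gives `+∫∫ω₋²`
(compression concentrates), diffusion gives `−2ν∫∫_{ω<0}|∇ω|²`; NO term from the zero set of `ω` (two-signed
data allowed). This is the enstrophy balance of Disproof §3 restricted to `ω₋`. -/
def NegEnstrophyLaw : Prop :=
  ∀ ν L a b : ℝ, 0 < ν → 0 < L → 0 < a → a < b →
  ∀ u v p : ℝ → ℝ → ℝ → ℝ,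
    IsStretchedLayerNSSolutionOn (Ioi 0) ν 1 1 L u v p →
    ContDiffOn ℝ 3 (fun q : ℝ × ℝ × ℝ => u q.1 q.2.1 q.2.2) (Ioi 0 ×ˢ univ) →
    ContDiffOn ℝ 3 (fun q : ℝ × ℝ × ℝ => v q.1 q.2.1 q.2.2) (Ioi 0 ×ˢ univ) →
    ExpTails (Icc a b) u v →
    negEnstrophy L (u b) (v b) - negEnstrophy L (u a) (v a) =
      ∫ t in a..b, (negEnstrophy L (u t) (v t) - 2 * ν * negPalinstrophy L (u t) (v t))

/-- **B2 · circulation floor.** Under shear tails the circulation per period is pinned by the far field,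
`∫∫ ω = −L·ΔU = −L`, hence `M₋ = L + M₊ ≥ L` on every slice. -/
def CirculationFloor : Prop :=
  ∀ L C k : ℝ, 0 < L → 0 < k → ∀ u v : ℝ → ℝ → ℝ,
    ContDiff ℝ 2 (fun q : ℝ × ℝ => u q.1 q.2) → ContDiff ℝ 2 (fun q : ℝ × ℝ => v q.1 q.2) →
    (∀ x y, u (x + L) y = u x y ∧ v (x + L) y = v x y) →
    (∀ x, Tendsto (fun y => u x y) atTop (𝓝 (1 / 2)) ∧ Tendsto (fun y => u x y) atBot (𝓝 (-(1 / 2)))) →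
    SliceTails C k u v → L ≤ negMass L u v

/-- **B3 · THE DYNAMICAL STUB — Nash-roundness floor (scale-free form of the crux).** There is ONE admissible
perturbation `θ` per period `L` such that, for all small `ν`, along every solution of the crux's class with shear
tails the negative vorticity is eventually ROUND in the Nash sense: `r(t) = Ω₋²/(M₋²P₋) ≥ r₀` for `t ≥ T₁`
(`T₁` may depend on `ν` and on the solution — harmless for a liminf). No scale, no location, no `ν` in the
inequality: it excludes exactly the sheet-like / dust-like states (the laminar member has `r → 0` like `√ν/L`, so
by Disproof §2 `θ` is load-bearing here too). Conjecturally `r(t) → 1/4π` (one Burgers core per period). -/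
def NashRoundnessFloor (r₀ : ℝ) : Prop :=
  ∀ L : ℝ, 0 < L → ∃ ν₀ : ℝ, 0 < ν₀ ∧ ∃ θ₁ θ₂ : ℝ → ℝ → ℝ, IsAdmissible L θ₁ θ₂ ∧
    ∀ ν : ℝ, 0 < ν → ν ≤ ν₀ → ∀ u v p : ℝ → ℝ → ℝ → ℝ, InCruxClass ν L θ₁ θ₂ u v p →
      (∀ a b : ℝ, 0 < a → a < b → ExpTails (Icc a b) u v) →
      ∃ T₁ : ℝ, 0 < T₁ ∧ ∀ t : ℝ, T₁ ≤ t →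
        r₀ * (negMass L (u t) (v t)) ^ 2 * negPalinstrophy L (u t) (v t) ≤ (negEnstrophy L (u t) (v t)) ^ 2

/-- **B4 · log-enstrophy clock transfer (PROVED; pure real analysis).** If `Ω′ = Ω − 2νP` on `(t₀, ∞)`,
`0 < Ω ≤ C`, `M ≥ L > 0`, `P ≥ 0` and the roundness floor `r₀ M² P ≤ Ω²` holds there, then for every `ε > 0`,
eventually `(r₀L²/2 − ε)·T ≤ ∫_{t₀+1}^T ν Ω`. (Proof: `(log Ω)′ = 1 − 2νP/Ω ≥ 1 − 2νΩ/(r₀L²)`; integrate and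
use `log Ω(T) ≤ log C`.) With `L·D ≥ ν Ω₋`, `M₋ ≥ L` (B2) and B1 this is the crux's floor with `c = r₀/2` for
`L ≤ 1` (and `≥ r₀/2 ≥ c·min(L,1)` for `L ≥ 1`); on the exact Burgers row `r = 1/4π` it returns `D = L/8π`, the
value measured by the refuter's DNS (Disproof §5). [folklore] -/
theorem clockTransfer {ν L r₀ t₀ C : ℝ} {Ω P M : ℝ → ℝ}
    (hν : 0 < ν) (hL : 0 < L) (hr : 0 < r₀)
    (hΩ : ∀ t, t₀ < t → HasDerivAt Ω (Ω t - 2 * ν * P t) t)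
    (hpos : ∀ t, t₀ < t → 0 < Ω t) (hbd : ∀ t, t₀ < t → Ω t ≤ C)
    (hP : ∀ t, t₀ < t → 0 ≤ P t) (hM : ∀ t, t₀ < t → L ≤ M t)
    (hround : ∀ t, t₀ < t → r₀ * (M t) ^ 2 * P t ≤ (Ω t) ^ 2) :
    ∀ ε : ℝ, 0 < ε → ∀ᶠ T in atTop, (r₀ * L ^ 2 / 2 - ε) * T ≤ ∫ t in (t₀ + 1)..T, ν * Ω t := by
  intro ε hε
  set t₁ : ℝ := t₀ + 1 with ht₁
  have ht₁' : t₀ < t₁ := by rw [ht₁]; linarith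
  -- continuity / measurability / integrability of `Ω` on the open half-line
  have hcont : ContinuousOn Ω (Ioi t₀) := fun t ht => (hΩ t ht).continuousAt.continuousWithinAt
  have hmeas : ∀ t ∈ Ioi t₀, StronglyMeasurableAtFilter Ω (𝓝 t) volume :=
    ContinuousOn.stronglyMeasurableAtFilter isOpen_Ioi hcont
  have hint : ∀ a b : ℝ, t₀ < a → t₀ < b → IntervalIntegrable Ω volume a b := by
    intro a b ha hb
    refine ContinuousOn.intervalIntegrable (hcont.mono ?_)
    intro x hx
    rcases mem_uIcc.1 hx with ⟨h1, -⟩ | ⟨h1, -⟩ <;> simp only [mem_Ioi] <;> linarith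
  -- the primitive `F` of `Ω` from `t₁` and its derivative
  set F : ℝ → ℝ := fun t => ∫ s in t₁..t, Ω s with hF
  have hFd : ∀ t, t₀ < t → HasDerivAt F (Ω t) t := fun t ht =>
    intervalIntegral.integral_hasDerivAt_right (hint t₁ t ht₁' ht) (hmeas t ht) (hΩ t ht).continuousAt
  -- the Lyapunov-type function `g = log Ω − t + c F`, `c = 2ν/(r₀L²)`
  set c : ℝ := 2 * ν / (r₀ * L ^ 2) with hc
  have hcpos : 0 < c := by rw [hc]; positivity
  set g : ℝ → ℝ := fun t => Real.log (Ω t) - t + c * F t with hg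
  have hgd : ∀ t, t₀ < t →
      HasDerivAt g ((Ω t - 2 * ν * P t) / Ω t - 1 + c * Ω t) t := by
    intro t ht
    have h1 : HasDerivAt (fun s => Real.log (Ω s)) ((Ω t - 2 * ν * P t) / Ω t) t :=
      (hΩ t ht).log (hpos t ht).ne'
    have h2 : HasDerivAt (fun s : ℝ => s) 1 t := hasDerivAt_id t
    have h3 : HasDerivAt (fun s => c * F s) (c * Ω t) t := (hFd t ht).const_mul c
    exact (h1.sub h2).add h3
  -- its derivative is nonnegative thanks to the roundness floor
  have hgd_nonneg : ∀ t, t₀ < t → 0 ≤ (Ω t - 2 * ν * P t) / Ω t - 1 + c * Ω t := by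
    intro t ht
    have hΩt := hpos t ht
    have hMt : L ≤ M t := hM t ht
    have hPt := hP t ht
    have hL2 : L ^ 2 ≤ (M t) ^ 2 := by
      have : 0 ≤ M t := hL.le.trans hMt
      nlinarith
    have h1 : r₀ * L ^ 2 * P t ≤ (Ω t) ^ 2 := by
      have : r₀ * L ^ 2 * P t ≤ r₀ * (M t) ^ 2 * P t := by
        have := mul_le_mul_of_nonneg_left hL2 hr.le
        exact mul_le_mul_of_nonneg_right this hPt
      exact this.trans (hround t ht)
    have heq : (Ω t - 2 * ν * P t) / Ω t - 1 + c * Ω t =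
        2 * ν * ((Ω t) ^ 2 - r₀ * L ^ 2 * P t) / (r₀ * L ^ 2 * Ω t) := by
      rw [hc]
      field_simp
      ring
    rw [heq]
    apply div_nonneg
    · exact mul_nonneg (by positivity) (sub_nonneg.2 h1)
    · positivity
  -- hence `g` is monotone on `[t₁, ∞)`
  have hmono : MonotoneOn g (Ici t₁) := by
    refine monotoneOn_of_hasDerivWithinAt_nonneg (f' := fun t => (Ω t - 2 * ν * P t) / Ω t - 1 + c * Ω t)
      (convex_Ici t₁) (fun t ht => (hgd t (ht₁'.trans_le ht)).continuousAt.continuousWithinAt) ?_ ?_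
    · intro t ht
      rw [interior_Ici] at ht ⊢
      exact (hgd t (ht₁'.trans ht)).hasDerivWithinAt
    · intro t ht
      rw [interior_Ici] at ht
      exact hgd_nonneg t (ht₁'.trans ht)
  -- unpack monotonicity between `t₁` and `T ≥ t₁`
  have hF0 : F t₁ = 0 := by simp [hF]
  have key : ∀ T, t₁ ≤ T → (T - t₁) + Real.log (Ω t₁) - Real.log C ≤ c * F T := by
    intro T hT
    have hm := hmono (self_mem_Ici) (mem_Ici.2 hT) hT
    simp only [hg, hF0, mul_zero, add_zero] at hm
    have hlog : Real.log (Ω T) ≤ Real.log C :=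
      Real.log_le_log (hpos T (ht₁'.trans_le hT)) (hbd T (ht₁'.trans_le hT))
    linarith
  -- conclude: eventually `(r₀L²/2 − ε) T ≤ ν F T = ∫_{t₁}^T ν Ω`
  set K : ℝ := t₁ - Real.log (Ω t₁) + Real.log C with hK
  have hcL : ν = c * (r₀ * L ^ 2 / 2) := by
    rw [hc]; field_simp
  refine eventually_atTop.2 ⟨max t₁ (|K| * (r₀ * L ^ 2 / 2) / ε + 1), fun T hT => ?_⟩
  have hT1 : t₁ ≤ T := le_of_max_le_left hT
  have hT2 : |K| * (r₀ * L ^ 2 / 2) / ε + 1 ≤ T := le_of_max_le_right hT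
  have hkey := key T hT1
  rw [intervalIntegral.integral_const_mul]
  change (r₀ * L ^ 2 / 2 - ε) * T ≤ ν * F T
  have hA : 0 < r₀ * L ^ 2 / 2 := by positivity
  -- from `key`: ν F T ≥ (r₀L²/2) (T − K)
  have h1 : (r₀ * L ^ 2 / 2) * (T - K) ≤ ν * F T := by
    have := mul_le_mul_of_nonneg_left hkey hA.le
    calc (r₀ * L ^ 2 / 2) * (T - K) = (r₀ * L ^ 2 / 2) * ((T - t₁) + Real.log (Ω t₁) - Real.log C) := by
            rw [hK]; ring
      _ ≤ (r₀ * L ^ 2 / 2) * (c * F T) := this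
      _ = ν * F T := by rw [hcL]; ring
  -- and `ε T ≥ (r₀L²/2) K` for `T` large
  have h2 : (r₀ * L ^ 2 / 2) * K ≤ ε * T := by
    have hKabs : K ≤ |K| := le_abs_self K
    have hT3 : |K| * (r₀ * L ^ 2 / 2) / ε ≤ T := by linarith
    have := (div_le_iff₀ hε).1 hT3
    nlinarith [abs_nonneg K]
  nlinarith [h1, h2]

/-! ## §A — the ordered ribbon and the strain-forged core -/

/-- **Kida–Neu forge trajectory** (regular coordinates). A uniform-vorticity ellipse in the crux's carrier field
`(0, −y)` = isotropic compression `−½(x, y)` + pure strain `(½x, −½y)`, plus its own Kirchhoff self-induction,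
stays an exact ellipse; its vorticity is `ω(t) = ω₀eᵗ` (axial stretching), its area `A₀e^{−t}`, and its SHAPE
`(p, q) = m·(cos 2θ, sin 2θ)`, `m = (λ − 1)/(λ + 1)` (`λ = a/b` the aspect ratio, `θ` the angle of the major axis
to the `x`-axis), obeys the planar system below (Kida 1981 / Moore–Saffman (19)–(20) in Saffman §9.3 with
`γ = ½`, `ε = 0`, rewritten on the unit disc so that the circle `m = 0` is a regular point). -/
def IsForgeTrajectory (ω₀ : ℝ) (p q : ℝ → ℝ) : Prop :=
  ∀ t : ℝ, 0 ≤ t →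
    HasDerivAt p ((1 - p t ^ 2 + q t ^ 2) / 2 - ω₀ * Real.exp t / 2 * (1 - p t ^ 2 - q t ^ 2) * q t) t ∧
    HasDerivAt q (-(p t * q t) + ω₀ * Real.exp t / 2 * (1 - p t ^ 2 - q t ^ 2) * p t) t

/-- **A1 · the compression forges a round core (fast-rotation boundedness; ODE lemma, first lemma of the line).**
There are `K > 0` and `m⋆ < 1` such that every forge trajectory with `|ω₀| ≥ K` (the sign of `ω₀` only reverses
the sense of rotation) started at aspect ratio `λ₀ ≤ 2` (`m₀ ≤ 1/3`) keeps `m(t) ≤ m⋆`, i.e. `λ(t) ≤ (1+m⋆)/(1−m⋆)`,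
for all `t ≥ 0`: the fat blob never flattens into a layer while the compression thins it to the Burgers scale.
(Numerics, this folder `ode/kidaneu.py`: `K = 2` gives `sup λ ≤ 7.2`, `K = 20` gives `≤ 2.5`; `ω₀ = ½` from
`λ₀ = 2`, `θ₀ = 0` LOCKS and reaches `λ ≈ 200` by `t = 5` — Neu's layer branch, the threshold is real.) -/
def KidaNeuForge : Prop :=
  ∃ K m : ℝ, 0 < K ∧ m < 1 ∧ ∀ (ω₀ : ℝ) (p q : ℝ → ℝ), K ≤ |ω₀| → IsForgeTrajectory ω₀ p q →
    p 0 ^ 2 + q 0 ^ 2 ≤ 1 / 9 → ∀ t : ℝ, 0 ≤ t → p t ^ 2 + q t ^ 2 ≤ m ^ 2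

/-- The ORDERED-RIBBON vorticity design (top to bottom: blob row `−L` at height `h` | vorticity-free moat |
the Burgers sheet `−U_B′` (datum, not part of `θ`) | antilayer `+L` per period, parallel, centred at `−y_a`):
`ω_d(x, y) = −(L/2πs_b²) Σ_{j∈ℤ} e^{−((x − jL)² + (y − h)²)/2s_b²} + (1/(s_a√(2π))) e^{−(y + y_a)²/2s_a²}`. -/
def ribbonVorticity (L h s_b y_a s_a : ℝ) (x y : ℝ) : ℝ :=
  -(L / (2 * Real.pi * s_b ^ 2)) * (∑' j : ℤ, Real.exp (-((x - j * L) ^ 2 + (y - h) ^ 2) / (2 * s_b ^ 2))) +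
    (1 / (s_a * Real.sqrt (2 * Real.pi))) * Real.exp (-(y + y_a) ^ 2 / (2 * s_a ^ 2))

/-- **A2 · the ribbon datum is admissible up to an exponentially small far correction.** For every geometry and
every `η > 0` there is an admissible `θ` (C², `L`-periodic, compactly supported in `y`, divergence-free — zero net
circulation is automatic) whose vorticity EQUALS `ribbonVorticity` on `|y| ≤ R₀` and differs from it by at most
`η` in `L¹` of the period strip (construction: `θ = ∇⊥(χ_R ψ_d)`, `Δψ_d = ω_d`; the `k = 0` mode is exact,
the `k ≠ 0` modes decay like `e^{−2π|k||y|/L}` before the cut-off). Size M. -/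
def RibbonDatum : Prop :=
  ∀ L h s_b y_a s_a η R₀ : ℝ, 0 < L → 0 < s_b → 0 < s_a → 0 < y_a → 0 < h → 0 < η → 0 < R₀ →
    ∃ θ₁ θ₂ : ℝ → ℝ → ℝ, IsAdmissible L θ₁ θ₂ ∧
      (∀ x y, |y| ≤ R₀ → vorticity θ₁ θ₂ x y = ribbonVorticity L h s_b y_a s_a x y) ∧
      ∫ x in Ioc 0 L, ∫ y, |vorticity θ₁ θ₂ x y - ribbonVorticity L h s_b y_a s_a x y| ≤ η

/-- **A3 · THE LINE'S DYNAMICAL STUB — roundness floor ON THE RIBBON DATUM.** For the ordered-ribbon `θ` of A2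
(fixed geometry `h = 5L/4`, `s_b = s_a = L/16`, `y_a = L/6`, say), every solution of the crux's class with tails
has Nash roundness `≥ r₀` eventually, for all `ν ≤ ν₀(L)`. Content: (i) forge (A1 + perturbation by the image and
band strains, both ≤ 5 % of `|ω₀|`), (ii) TOPOLOGICAL SHIELD — all positive vorticity starts below the closed,
non-contractible material curve of the sheet, the blob above it, and co-winding dilutes sheet and antilayer
identically, so the blob's `−L` can only be reached through a consumed sheet (worst case: band self-annihilates,
blob intact) — and (iii) large-`Re_Γ` robustness of the forged core (`Re_Γ = L/ν → ∞` helps). -/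
def RibbonRoundnessFloor (r₀ : ℝ) : Prop :=
  ∀ L : ℝ, 0 < L → ∃ ν₀ : ℝ, 0 < ν₀ ∧ ∃ θ₁ θ₂ : ℝ → ℝ → ℝ, IsAdmissible L θ₁ θ₂ ∧
    (∀ x y, |y| ≤ 4 * L → vorticity θ₁ θ₂ x y = ribbonVorticity L (5 * L / 4) (L / 16) (L / 6) (L / 16) x y) ∧
    ∀ ν : ℝ, 0 < ν → ν ≤ ν₀ → ∀ u v p : ℝ → ℝ → ℝ → ℝ, InCruxClass ν L θ₁ θ₂ u v p →
      (∀ a b : ℝ, 0 < a → a < b → ExpTails (Icc a b) u v) →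
      ∃ T₁ : ℝ, 0 < T₁ ∧ ∀ t : ℝ, T₁ ≤ t →
        r₀ * (negMass L (u t) (v t)) ^ 2 * negPalinstrophy L (u t) (v t) ≤ (negEnstrophy L (u t) (v t)) ^ 2

/-- The ribbon floor is an instance of the scale-free floor (bookkeeping). -/
theorem nashRoundnessFloor_of_ribbon {r₀ : ℝ} (h : RibbonRoundnessFloor r₀) : NashRoundnessFloor r₀ := by
  intro L hL
  obtain ⟨ν₀, hν₀, θ₁, θ₂, hadm, -, hall⟩ := h L hL
  exact ⟨ν₀, hν₀, θ₁, θ₂, hadm, hall⟩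

end Summit.AnomalousDissipation.AnomalousDissipation.Cruxes.StrainedLayerLaw.SketchR2K4
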